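import Literature.Barriers.AtomisticToContinuum.NoBVEstimatesMultiDFinitePropagationZeroth
import Literature.Analysis.Calculus.JointSmoothnessPartials
import HarnessLib

/-!
# Classical solutions of the linearised system (4) with `C_c^∞` data, by Fourier synthesis

First brick of the programme to discharge `Rauch1986_smallAmplitudeExpansionL2`
(`NoBVEstimatesMultiDSmallAmplitude.lean`), the `L²` small-amplitude expansion quoted by
[Rauch1986, Proof of Theorem p. 482] from the Local Existence Theorem. That fact asserts, first,
that the linearised system (4), `A₀(ū)∂ₜv + Σⱼ Aⱼ(ū)∂ⱼv + B′(ū)v = 0`, `v(0) = φ ∈ C_c^∞(ℝᵈ; ℝᵏ)`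
— in the tree the constant-coefficient system `ofConstant A₀ A B₁` — HAS a classical solution on
`[0, T]`. This file constructs it for every constant-coefficient system in Rauch's class at `0`
(both branches: symmetrizable, or `A₀` invertible and strictly hyperbolic) and every `T > 0`:

* `fwdSolC A₀ A B₁ ψ t = M_t(D)ψ` — the Fourier synthesis `𝓕⁻¹[M_t 𝓕ψ]` with Rauch's multiplier
  `M_t(ξ) = rauchSymbol A₀ A B₁ t ξ = exp(-t A₀⁻¹(2πi Σ ξ_l A_l + B₁))`, for complex data
  `ψ ∈ C_c^∞(ℝᵈ; ℂᵏ)`; Brenner's bound `‖M_t(ξ)‖ ≤ C(T)` for `|t| ≤ T`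
  (`exists_norm_rauchSymbol_apply_le`, both branches) makes all the Fourier integrals absolutely
  convergent;
* `fwdSolC_zero` (`v(0) = ψ`, Fourier inversion), `fderiv_fwdSolC_apply` (`∂ⱼ M_t(D)ψ = M_t(D)∂ⱼψ`),
  `hasDerivAt_fwdSolC` (`∂ₜv = 𝓕⁻¹[-G M_t 𝓕ψ]`, differentiation under the integral),
  `fwd_eqn` (the equation `A₀∂ₜv + Σ Aⱼ∂ⱼv + B₁v = 0`, from `A₀G(ξ) = 2πiΣξⱼAⱼ + B₁` on the
  Fourier side);
* `contDiff_one_fwdSolC` — `v` is JOINTLY `C¹` in `(t, x)`: both partial derivatives are Fourier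
  integrals jointly continuous in `(t, x)` (dominated convergence), and continuous partial
  derivatives give a `C¹` map (`Literature.Analysis.Calculus.contDiffOn_succ_of_partial`,
  Dieudonné (8.9.1));
* `fourierSolution A₀ A B₁ φ = Re M_t(D)φ_ℂ` for real data `φ ∈ C_c^∞(ℝᵈ; ℝᵏ)`:
  `isClassicalSolution_fourierSolution` — a classical solution of `ofConstant A₀ A B₁` on `[0, T]`
  in the sense of `QuasilinearSystem.IsClassicalSolution`, with `fourierSolution_zero`
  (`v(0) = φ`); `fourierSolution_eq_zero_of_norm_gt` (compact support of the slices, from the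
  finite propagation speed of the tree, `hasPropagationSpeed_ofConstant_zeroth`) and
  `fourier_cplx_fourierSolution` (`𝓕v(t) = M_t 𝓕φ`).

This is the classical Fourier treatment of constant-coefficient hyperbolic systems
[Brenner1973, §5 (5.3)–(5.4) p. 92], [Rauch1986, Proof of Theorem p. 483 ("`M` is the Fourier
multiplier ... solution operator of (4)")]. Everything is proved; no named fact and no `sorry` is
introduced.

## References

* [Rauch1986] J. Rauch, Comm. Math. Phys. 106 (1986) 481–484: (4) p. 482, Proof of Theorem
  p. 483.
* [Brenner1973] P. Brenner, Ark. Mat. 11 (1973) 75–101: (0.3) p. 75, (5.3)–(5.4) p. 92.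
* J. Dieudonné, *Foundations of Modern Analysis* (1960), (8.9.1).
-/

noncomputable section

open MeasureTheory Set Filter Matrix FourierTransform Metric Complex
open scoped ENNReal NNReal ContDiff Topology RealInnerProductSpace Matrix.Norms.Operator

namespace Literature.Barriers.AtomisticToContinuum

open Literature.Analysis.Fourier Literature.Analysis.FluidPDE Literature.Analysis.Calculus
  QuasilinearSystem

variable {d k : ℕ}

/-! ### Rauch's multiplier: bounds, time derivative, joint continuity -/

section Symbol

variable {A₀ : Matrix (Fin k) (Fin k) ℝ} {A : Fin d → Matrix (Fin k) (Fin k) ℝ}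
  {B₁ : (Fin k → ℝ) →L[ℝ] (Fin k → ℝ)}

/-- **Brenner's bound with a nonnegative constant**: in Rauch's class at `0` there is `C₀ ≥ 0`
with `|M_t(ξ)ᵢⱼ| ≤ C₀` for `|t| ≤ S`, all `ξ`. [cite: Brenner1973, (0.3) p. 75] -/
theorem exists_symbolBound (hS : (ofConstant A₀ A B₁).IsRauchClass 0) (S : ℝ) :
    ∃ C₀ : ℝ, 0 ≤ C₀ ∧ ∀ t : ℝ, |t| ≤ S → ∀ (ξ : Space d) (a b : Fin k),
      ‖rauchSymbol A₀ A B₁ t ξ a b‖ ≤ C₀ := by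
  obtain ⟨C₀, hC⟩ := exists_norm_rauchSymbol_apply_le hS S
  exact ⟨max C₀ 0, le_max_right _ _, fun t ht ξ a b => (hC t ht ξ a b).trans (le_max_left _ _)⟩

/-- `A₀` is invertible for a constant-coefficient system in Rauch's class at `0`. [cite: Rauch1986, p. 482] -/
theorem det_ne_zero_of_isRauchClass (hS : (ofConstant A₀ A B₁).IsRauchClass 0) : A₀.det ≠ 0 :=
  (exists_continuous_symmetrizer_family hS).1

variable (A₀ A B₁) in
/-- The matrix of the zeroth-order term `B₁`. [folklore] -/
abbrev bMatrix : Matrix (Fin k) (Fin k) ℝ := LinearMap.toMatrix' (B₁ : (Fin k → ℝ) →ₗ[ℝ] (Fin k → ℝ))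

/-- `B₁ w = (bMatrix B₁) w`. [folklore] -/
theorem bMatrix_mulVec (w : Fin k → ℝ) : bMatrix B₁ *ᵥ w = B₁ w := by
  rw [bMatrix, LinearMap.toMatrix'_mulVec]; rfl

variable (A₀ A B₁) in
/-- The constant in the affine bound of the generator: `K₁ = 2π ‖A₀⁻¹_ℂ‖ Σ_l ‖(A_l)_ℂ‖`. [folklore] -/
def genBound₁ : ℝ :=
  2 * Real.pi * ‖(A₀⁻¹).map (algebraMap ℝ ℂ)‖ * ∑ l, ‖(A l).map (algebraMap ℝ ℂ)‖

variable (A₀ A B₁) in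
/-- The constant term in the affine bound of the generator: `K₀ = ‖A₀⁻¹_ℂ‖ ‖(B₁)_ℂ‖`. [folklore] -/
def genBound₀ : ℝ :=
  ‖(A₀⁻¹).map (algebraMap ℝ ℂ)‖ * ‖(bMatrix B₁).map (algebraMap ℝ ℂ)‖

/-- `0 ≤ K₁`. [folklore] -/
theorem genBound₁_nonneg : 0 ≤ genBound₁ A₀ A := by
  unfold genBound₁
  exact mul_nonneg (mul_nonneg (by positivity) (norm_nonneg _))
    (Finset.sum_nonneg fun _ _ => norm_nonneg _)

/-- `0 ≤ K₀`. [folklore] -/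
theorem genBound₀_nonneg : 0 ≤ genBound₀ A₀ B₁ := by
  unfold genBound₀; positivity

/-- **Affine bound for the generator**: `‖G(ξ)‖ ≤ K₁‖ξ‖ + K₀`,
`G(ξ) = A₀⁻¹_ℂ(2πi Σ ξ_l A_l + B₁)_ℂ`. [folklore] -/
theorem norm_rauchGenerator_le (ξ : Space d) :
    ‖rauchGenerator A₀ A B₁ ξ‖ ≤ genBound₁ A₀ A * ‖ξ‖ + genBound₀ A₀ B₁ := by
  unfold rauchGenerator genBound₁ genBound₀
  refine (Matrix.linfty_opNorm_mul _ _).trans ?_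
  have hsum : ‖∑ l, (2 * Real.pi * ξ l * Complex.I) • (A l).map (algebraMap ℝ ℂ)‖ ≤
      2 * Real.pi * (∑ l, ‖(A l).map (algebraMap ℝ ℂ)‖) * ‖ξ‖ := by
    refine (norm_sum_le _ _).trans ?_
    rw [Finset.mul_sum, Finset.sum_mul]
    refine Finset.sum_le_sum fun l _ => ?_
    rw [norm_smul]
    have h1 : ‖(2 * Real.pi * ξ l * Complex.I : ℂ)‖ = 2 * Real.pi * |ξ l| := by
      rw [norm_mul, Complex.norm_I, mul_one]
      push_cast
      rw [norm_mul, Complex.norm_real, Real.norm_eq_abs]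
      congr 1
      rw [show ((2 : ℂ) * (Real.pi : ℂ)) = ((2 * Real.pi : ℝ) : ℂ) by push_cast; ring,
        Complex.norm_real, Real.norm_eq_abs, abs_of_pos Real.two_pi_pos]
    rw [h1]
    have h2 : |ξ l| ≤ ‖ξ‖ := by simpa using PiLp.norm_apply_le ξ l
    calc 2 * Real.pi * |ξ l| * ‖(A l).map (algebraMap ℝ ℂ)‖
        ≤ 2 * Real.pi * ‖ξ‖ * ‖(A l).map (algebraMap ℝ ℂ)‖ := by gcongr
      _ = 2 * Real.pi * ‖(A l).map (algebraMap ℝ ℂ)‖ * ‖ξ‖ := by ring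
  calc ‖(A₀⁻¹).map (algebraMap ℝ ℂ)‖ *
        ‖∑ l, (2 * Real.pi * ξ l * Complex.I) • (A l).map (algebraMap ℝ ℂ) +
          (LinearMap.toMatrix' (B₁ : (Fin k → ℝ) →ₗ[ℝ] (Fin k → ℝ))).map (algebraMap ℝ ℂ)‖
      ≤ ‖(A₀⁻¹).map (algebraMap ℝ ℂ)‖ *
          (2 * Real.pi * (∑ l, ‖(A l).map (algebraMap ℝ ℂ)‖) * ‖ξ‖ +
            ‖(bMatrix B₁).map (algebraMap ℝ ℂ)‖) :=
        mul_le_mul_of_nonneg_left ((norm_add_le _ _).trans (add_le_add hsum le_rfl))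
          (norm_nonneg _)
    _ = _ := by ring

/-- **Time derivative of Rauch's multiplier**: `∂ₜ M_t(ξ) = -G(ξ) M_t(ξ)`. [folklore] -/
theorem hasDerivAt_rauchSymbol (t : ℝ) (ξ : Space d) :
    HasDerivAt (fun s : ℝ => rauchSymbol A₀ A B₁ s ξ)
      (-(rauchGenerator A₀ A B₁ ξ) * rauchSymbol A₀ A B₁ t ξ) t := by
  have hkey : ∀ s : ℝ, -(s : ℂ) • rauchGenerator A₀ A B₁ ξ = (s : ℝ) • (-(rauchGenerator A₀ A B₁ ξ)) :=
    fun s => by rw [smul_neg, ← neg_smul, ← Complex.ofReal_neg, Complex.coe_smul]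
  have hfun : (fun s : ℝ => rauchSymbol A₀ A B₁ s ξ) =
      fun s : ℝ => NormedSpace.exp (s • (-(rauchGenerator A₀ A B₁ ξ))) := by
    funext s
    rw [rauchSymbol, hkey]
  have hval : rauchSymbol A₀ A B₁ t ξ = NormedSpace.exp (t • (-(rauchGenerator A₀ A B₁ ξ))) := by
    rw [rauchSymbol, hkey]
  rw [hfun, hval]
  exact hasDerivAt_exp_smul_const' (𝕂 := ℝ) (-(rauchGenerator A₀ A B₁ ξ)) t

variable (A₀ A B₁) in
/-- Rauch's multiplier is jointly continuous in `(t, ξ)`. [folklore] -/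
theorem continuous_rauchSymbol_uncurry :
    Continuous fun p : ℝ × Space d => rauchSymbol A₀ A B₁ p.1 p.2 := by
  unfold rauchSymbol
  refine NormedSpace.exp_continuous.comp ?_
  exact ((Complex.continuous_ofReal.comp continuous_fst).neg.smul
    ((continuous_rauchGenerator A₀ A B₁).comp continuous_snd))

/-- Operator-norm bound from the entrywise bound: `‖M_t(ξ)‖ ≤ k C₀`. [folklore] -/
theorem norm_rauchSymbol_le_of {C₀ : ℝ} (hC0 : 0 ≤ C₀) {t : ℝ}
    (hC : ∀ (ξ : Space d) (a b : Fin k), ‖rauchSymbol A₀ A B₁ t ξ a b‖ ≤ C₀) (ξ : Space d) :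
    ‖rauchSymbol A₀ A B₁ t ξ‖ ≤ k * C₀ :=
  linfty_opNorm_le_of_entry_le hC0 (hC ξ)

/-- `‖M_t(ξ) w‖ ≤ k C₀ ‖w‖` from the entrywise bound. [folklore] -/
theorem norm_rauchSymbol_mulVec_le {C₀ : ℝ} (hC0 : 0 ≤ C₀) {t : ℝ}
    (hC : ∀ (ξ : Space d) (a b : Fin k), ‖rauchSymbol A₀ A B₁ t ξ a b‖ ≤ C₀) (w : Fin k → ℂ)
    (ξ : Space d) : ‖rauchSymbol A₀ A B₁ t ξ *ᵥ w‖ ≤ k * C₀ * ‖w‖ :=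
  (Matrix.linfty_opNorm_mulVec _ _).trans
    (mul_le_mul_of_nonneg_right (norm_rauchSymbol_le_of hC0 hC ξ) (norm_nonneg _))

/-- **`A₀` through the generator**: `A₀_ℂ G(ξ) = Σ_l (2πξ_l i)(A_l)_ℂ + (B₁)_ℂ`. [folklore] -/
theorem map_A0_mul_rauchGenerator (hdet : A₀.det ≠ 0) (ξ : Space d) :
    A₀.map (algebraMap ℝ ℂ) * rauchGenerator A₀ A B₁ ξ =
      ∑ l, (2 * Real.pi * ξ l * Complex.I) • (A l).map (algebraMap ℝ ℂ) +
        (bMatrix B₁).map (algebraMap ℝ ℂ) := by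
  have hunit : IsUnit A₀.det := isUnit_iff_ne_zero.2 hdet
  unfold rauchGenerator
  rw [← Matrix.mul_assoc, ← Matrix.map_mul, mul_nonsing_inv _ hunit,
    Matrix.map_one _ (map_zero _) (map_one _), Matrix.one_mul]

end Symbol

/-! ### The Fourier synthesis `M_t(D)ψ` for complex data -/

section Forward

variable {A₀ : Matrix (Fin k) (Fin k) ℝ} {A : Fin d → Matrix (Fin k) (Fin k) ℝ}
  {B₁ : (Fin k → ℝ) →L[ℝ] (Fin k → ℝ)}

variable (A₀ A B₁) in
/-- **The Fourier solution** `v(t) = M_t(D)ψ = 𝓕⁻¹[M_t 𝓕ψ]` of `A₀∂ₜv + Σ Aⱼ∂ⱼv + B₁v = 0`,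
`v(0) = ψ`, for complex data `ψ`. [cite: Rauch1986, Proof of Theorem p. 483] -/
def fwdSolC (ψ : Space d → Fin k → ℂ) (t : ℝ) (x : Space d) : Fin k → ℂ :=
  multiplierOp (rauchSymbol A₀ A B₁ t) ψ x

variable (A₀ A B₁) in
/-- The Fourier-side time derivative `(-G(ξ) M_t(ξ)) 𝓕ψ(ξ)`. [folklore] -/
def fwdSolDtF (ψ : Space d → Fin k → ℂ) (t : ℝ) (ξ : Space d) : Fin k → ℂ :=
  (-(rauchGenerator A₀ A B₁ ξ) * rauchSymbol A₀ A B₁ t ξ) *ᵥ 𝓕 ψ ξ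

variable (A₀ A B₁) in
/-- The time derivative of the Fourier solution, `∂ₜv(t, x) = 𝓕⁻¹[(-G M_t) 𝓕ψ](x)`. [folklore] -/
def fwdSolDt (ψ : Space d → Fin k → ℂ) (t : ℝ) (x : Space d) : Fin k → ℂ :=
  𝓕⁻ (fwdSolDtF A₀ A B₁ ψ t) x

/-- **`v(0) = ψ`** (`M_0 = 1` and Fourier inversion). [folklore] -/
theorem fwdSolC_zero {ψ : Space d → Fin k → ℂ} (hψ : ContDiff ℝ ∞ ψ) (hc : HasCompactSupport ψ)
    (x : Space d) : fwdSolC A₀ A B₁ ψ 0 x = ψ x := by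
  rw [fwdSolC, multiplierOp_apply, rauchSymbol_zero]
  have h1 : (fun ξ => (1 : Space d → Matrix (Fin k) (Fin k) ℂ) ξ *ᵥ 𝓕 ψ ξ) = 𝓕 ψ := by
    funext ξ; rw [Pi.one_apply, Matrix.one_mulVec]
  rw [h1, hψ.continuous.fourierInv_fourier_eq (hψ.continuous.integrable_of_hasCompactSupport hc)
    (integrable_fourier_of_contDiff hψ hc)]

/-- `M_t 𝓕ψ` is integrable (bounded symbol, `𝓕ψ` Schwartz). [folklore] -/
theorem integrable_rauchSymbol_mulVec_fourier {C₀ : ℝ} (hC0 : 0 ≤ C₀) {t : ℝ}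
    (hC : ∀ (ξ : Space d) (a b : Fin k), ‖rauchSymbol A₀ A B₁ t ξ a b‖ ≤ C₀)
    {ψ : Space d → Fin k → ℂ} (hψ : ContDiff ℝ ∞ ψ) (hc : HasCompactSupport ψ) :
    Integrable fun ξ => rauchSymbol A₀ A B₁ t ξ *ᵥ 𝓕 ψ ξ :=
  integrable_mulVec_fourier (measurable_rauchSymbol_apply A₀ A B₁ t) hC0 hC (hc.toSchwartzMap hψ)

/-- **Spatial derivatives**: `∂ᵥ M_t(D)ψ = M_t(D) ∂ᵥψ`. [folklore] -/
theorem fderiv_fwdSolC_apply (hS : (ofConstant A₀ A B₁).IsRauchClass 0)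
    {ψ : Space d → Fin k → ℂ} (hψ : ContDiff ℝ ∞ ψ) (hc : HasCompactSupport ψ) (t : ℝ)
    (x v : Space d) :
    fderiv ℝ (fwdSolC A₀ A B₁ ψ t) x v = fwdSolC A₀ A B₁ (fun y => fderiv ℝ ψ y v) t x := by
  obtain ⟨C₀, hC0, hC⟩ := exists_symbolBound hS |t|
  exact fderiv_multiplierOp_apply_of_contDiff (measurable_rauchSymbol_apply A₀ A B₁ t) hC0
    (hC t le_rfl) hψ hc x v

/-- `M_t(D)ψ` is differentiable in `x`. [folklore] -/
theorem differentiable_fwdSolC (hS : (ofConstant A₀ A B₁).IsRauchClass 0)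
    {ψ : Space d → Fin k → ℂ} (hψ : ContDiff ℝ ∞ ψ) (hc : HasCompactSupport ψ) (t : ℝ) :
    Differentiable ℝ (fwdSolC A₀ A B₁ ψ t) := by
  obtain ⟨C₀, hC0, hC⟩ := exists_symbolBound hS |t|
  exact differentiable_multiplierOp_of_contDiff (measurable_rauchSymbol_apply A₀ A B₁ t) hC0
    (hC t le_rfl) hψ hc

/-- Pointwise bound for the Fourier-side time derivative:
`‖(-G M_t)𝓕ψ(ξ)‖ ≤ kC₀ (K₀‖𝓕ψ(ξ)‖ + K₁ ‖ξ‖‖𝓕ψ(ξ)‖)`. [folklore] -/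
theorem norm_fwdSolDtF_le {C₀ : ℝ} (hC0 : 0 ≤ C₀) {t : ℝ}
    (hC : ∀ (ξ : Space d) (a b : Fin k), ‖rauchSymbol A₀ A B₁ t ξ a b‖ ≤ C₀)
    (ψ : Space d → Fin k → ℂ) (ξ : Space d) :
    ‖fwdSolDtF A₀ A B₁ ψ t ξ‖ ≤ (k * C₀) *
      (genBound₀ A₀ B₁ * ‖𝓕 ψ ξ‖ + genBound₁ A₀ A * (‖ξ‖ * ‖𝓕 ψ ξ‖)) := by
  rw [fwdSolDtF]
  refine (Matrix.linfty_opNorm_mulVec _ _).trans ?_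
  have h1 : ‖-(rauchGenerator A₀ A B₁ ξ) * rauchSymbol A₀ A B₁ t ξ‖ ≤
      (genBound₁ A₀ A * ‖ξ‖ + genBound₀ A₀ B₁) * (k * C₀) := by
    refine (Matrix.linfty_opNorm_mul _ _).trans ?_
    rw [norm_neg]
    exact mul_le_mul (norm_rauchGenerator_le ξ) (norm_rauchSymbol_le_of hC0 hC ξ) (norm_nonneg _)
      (add_nonneg (mul_nonneg genBound₁_nonneg (norm_nonneg _)) genBound₀_nonneg)
  calc ‖-(rauchGenerator A₀ A B₁ ξ) * rauchSymbol A₀ A B₁ t ξ‖ * ‖𝓕 ψ ξ‖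
      ≤ (genBound₁ A₀ A * ‖ξ‖ + genBound₀ A₀ B₁) * (k * C₀) * ‖𝓕 ψ ξ‖ :=
        mul_le_mul_of_nonneg_right h1 (norm_nonneg _)
    _ = _ := by ring

/-- The Fourier transform of a `C_c^∞` field is continuous. [folklore] -/
theorem continuous_fourier_of_contDiff {ψ : Space d → Fin k → ℂ} (hψ : ContDiff ℝ ∞ ψ)
    (hc : HasCompactSupport ψ) : Continuous (𝓕 ψ) := by
  have := (𝓕 (hc.toSchwartzMap hψ)).continuous
  rwa [SchwartzMap.fourier_coe] at this

/-- The Fourier-side time derivative is continuous in `ξ`. [folklore] -/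
theorem continuous_fwdSolDtF {ψ : Space d → Fin k → ℂ} (hψ : ContDiff ℝ ∞ ψ)
    (hc : HasCompactSupport ψ) (t : ℝ) : Continuous (fwdSolDtF A₀ A B₁ ψ t) := by
  unfold fwdSolDtF
  have h1 : Continuous fun ξ => -(rauchGenerator A₀ A B₁ ξ) * rauchSymbol A₀ A B₁ t ξ :=
    (continuous_rauchGenerator A₀ A B₁).neg.mul (continuous_rauchSymbol A₀ A B₁ t)
  exact (mulVecBilin (k := k)).continuous₂.comp (h1.prodMk (continuous_fourier_of_contDiff hψ hc))

/-- `x ↦ M_{τ(x)}(η(x))` is continuous along continuous `τ`, `η`. [folklore] -/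
theorem continuous_rauchSymbol_comp {X : Type*} [TopologicalSpace X] {τ : X → ℝ}
    {η : X → Space d} (hτ : Continuous τ) (hη : Continuous η) :
    Continuous fun x => rauchSymbol A₀ A B₁ (τ x) (η x) := by
  unfold rauchSymbol
  refine NormedSpace.exp_continuous.comp ?_
  exact (Complex.continuous_ofReal.comp hτ).neg.smul ((continuous_rauchGenerator A₀ A B₁).comp hη)

/-- `x ↦ M_{τ(x)}(η(x)) 𝓕ψ(η(x))` is continuous along continuous `τ`, `η`. [folklore] -/
theorem continuous_rauchSymbol_mulVec_fourier_comp {X : Type*} [TopologicalSpace X] {τ : X → ℝ}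
    {η : X → Space d} (hτ : Continuous τ) (hη : Continuous η) {ψ : Space d → Fin k → ℂ}
    (hψ : ContDiff ℝ ∞ ψ) (hc : HasCompactSupport ψ) :
    Continuous fun x => rauchSymbol A₀ A B₁ (τ x) (η x) *ᵥ 𝓕 ψ (η x) :=
  (mulVecBilin (k := k)).continuous₂.comp ((continuous_rauchSymbol_comp hτ hη).prodMk
    ((continuous_fourier_of_contDiff hψ hc).comp hη))

/-- `x ↦ (-G M_{τ(x)}) 𝓕ψ (η(x))` is continuous along continuous `τ`, `η`. [folklore] -/
theorem continuous_fwdSolDtF_comp {X : Type*} [TopologicalSpace X] {τ : X → ℝ}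
    {η : X → Space d} (hτ : Continuous τ) (hη : Continuous η) {ψ : Space d → Fin k → ℂ}
    (hψ : ContDiff ℝ ∞ ψ) (hc : HasCompactSupport ψ) :
    Continuous fun x => fwdSolDtF A₀ A B₁ ψ (τ x) (η x) := by
  unfold fwdSolDtF
  have h1 : Continuous fun x =>
      -(rauchGenerator A₀ A B₁ (η x)) * rauchSymbol A₀ A B₁ (τ x) (η x) :=
    ((continuous_rauchGenerator A₀ A B₁).comp hη).neg.mul (continuous_rauchSymbol_comp hτ hη)
  exact (mulVecBilin (k := k)).continuous₂.comp
    (h1.prodMk ((continuous_fourier_of_contDiff hψ hc).comp hη))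

/-- The majorant `K (K₀‖𝓕ψ‖ + K₁ ‖ξ‖‖𝓕ψ‖)` is integrable for `ψ ∈ C_c^∞`. [folklore] -/
theorem integrable_fwdMajorant {ψ : Space d → Fin k → ℂ} (hψ : ContDiff ℝ ∞ ψ)
    (hc : HasCompactSupport ψ) (K : ℝ) :
    Integrable fun ξ : Space d =>
      K * (genBound₀ A₀ B₁ * ‖𝓕 ψ ξ‖ + genBound₁ A₀ A * (‖ξ‖ * ‖𝓕 ψ ξ‖)) :=
  ((((integrable_fourier_of_contDiff hψ hc).norm.const_mul _).add
    ((integrable_norm_mul_norm_fourier hψ hc).const_mul _)).const_mul K)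

/-- The Fourier-side time derivative is integrable. [folklore] -/
theorem integrable_fwdSolDtF {C₀ : ℝ} (hC0 : 0 ≤ C₀) {t : ℝ}
    (hC : ∀ (ξ : Space d) (a b : Fin k), ‖rauchSymbol A₀ A B₁ t ξ a b‖ ≤ C₀)
    {ψ : Space d → Fin k → ℂ} (hψ : ContDiff ℝ ∞ ψ) (hc : HasCompactSupport ψ) :
    Integrable (fwdSolDtF A₀ A B₁ ψ t) :=
  (integrable_fwdMajorant (A₀ := A₀) (A := A) (B₁ := B₁) hψ hc _).mono'
    (continuous_fwdSolDtF hψ hc t).aestronglyMeasurable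
    (Eventually.of_forall fun ξ => norm_fwdSolDtF_le hC0 hC ψ ξ)

/-- **Time derivative of the Fourier solution** (differentiation under the inverse Fourier
integral, dominated on `|s - t| < 1` by the majorant with the constant for `|s| ≤ |t| + 1`):
`∂ₜv(t, x) = 𝓕⁻¹[(-G M_t)𝓕ψ](x)`, at EVERY `t ∈ ℝ`. [folklore] -/
theorem hasDerivAt_fwdSolC (hS : (ofConstant A₀ A B₁).IsRauchClass 0)
    {ψ : Space d → Fin k → ℂ} (hψ : ContDiff ℝ ∞ ψ) (hc : HasCompactSupport ψ)
    (x : Space d) (t : ℝ) :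
    HasDerivAt (fun s => fwdSolC A₀ A B₁ ψ s x) (fwdSolDt A₀ A B₁ ψ t x) t := by
  obtain ⟨C₀, hC0, hC⟩ := exists_symbolBound hS (|t| + 1)
  -- the phase
  set E : Space d → ℂ := fun ξ => Complex.exp (((2 * Real.pi * ⟪ξ, x⟫ : ℝ) : ℂ) * I) with hE
  have hEn : ∀ ξ, ‖E ξ‖ = 1 := fun ξ => by rw [hE]; exact Complex.norm_exp_ofReal_mul_I _
  have hEc : Continuous E := Complex.continuous_exp.comp ((Complex.continuous_ofReal.comp
    (continuous_const.mul (continuous_id.inner continuous_const))).mul continuous_const)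
  -- the integrands
  set F : ℝ → Space d → Fin k → ℂ :=
    fun s ξ => E ξ • (rauchSymbol A₀ A B₁ s ξ *ᵥ 𝓕 ψ ξ) with hF
  set F' : ℝ → Space d → Fin k → ℂ := fun s ξ => E ξ • fwdSolDtF A₀ A B₁ ψ s ξ with hF'
  have hψF : Continuous (𝓕 ψ) := continuous_fourier_of_contDiff hψ hc
  have hFc : ∀ s, Continuous (F s) := fun s =>
    hEc.smul ((mulVecBilin (k := k)).continuous₂.comp
      ((continuous_rauchSymbol A₀ A B₁ s).prodMk hψF))
  have hF'c : ∀ s, Continuous (F' s) := fun s => hEc.smul (continuous_fwdSolDtF hψ hc s)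
  have htS : |t| ≤ |t| + 1 := by linarith
  have hFi : Integrable (F t) := by
    refine (integrable_rauchSymbol_mulVec_fourier hC0 (hC t htS) hψ hc).norm.mono'
      (hFc t).aestronglyMeasurable (Eventually.of_forall fun ξ => ?_)
    rw [hF]
    simp only [norm_smul, hEn, one_mul, le_refl]
  -- on the ball `|s - t| < 1` we have `|s| ≤ |t| + 1`
  have hball : ∀ s ∈ ball t 1, |s| ≤ |t| + 1 := fun s hs => by
    have h1 : |s - t| < 1 := by simpa [Real.dist_eq] using mem_ball.1 hs
    have h2 : |s| ≤ |s - t| + |t| := by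
      have := abs_add_le (s - t) t
      rwa [sub_add_cancel] at this
    linarith
  have key := hasDerivAt_integral_of_dominated_loc_of_deriv_le (μ := (volume : Measure (Space d)))
    (F := F) (F' := F') (x₀ := t) (s := ball t 1) (ball_mem_nhds t one_pos)
    (Eventually.of_forall fun s => (hFc s).aestronglyMeasurable) hFi
    (hF'c t).aestronglyMeasurable
    (Eventually.of_forall fun ξ s hs => ?_)
    (integrable_fwdMajorant (A₀ := A₀) (A := A) (B₁ := B₁) hψ hc (k * C₀))
    (Eventually.of_forall fun ξ s _ => ?_)
  · -- identify the integrals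
    have h1 : (fun s => fwdSolC A₀ A B₁ ψ s x) = fun s => ∫ ξ, F s ξ := by
      funext s
      rw [fwdSolC, multiplierOp_apply, Real.fourierInv_eq']
    have h2 : fwdSolDt A₀ A B₁ ψ t x = ∫ ξ, F' t ξ := by
      rw [fwdSolDt, Real.fourierInv_eq']
    rw [h1, h2]
    exact key.2
  · -- domination
    rw [hF', norm_smul, hEn, one_mul]
    exact norm_fwdSolDtF_le hC0 (hC s (hball s hs)) ψ ξ
  · -- pointwise derivative in `s`
    simp only [hF, hF', fwdSolDtF]
    have h := hasDerivAt_smul_mulVec (hasDerivAt_const s (E ξ))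
      (hasDerivAt_rauchSymbol (A₀ := A₀) (A := A) (B₁ := B₁) s ξ) (hasDerivAt_const s (𝓕 ψ ξ))
    simpa using h

/-- **The equation in Fourier variables**: for every `ξ`,
`A₀_ℂ (-G M_t 𝓕ψ)(ξ) + Σⱼ (Aⱼ)_ℂ M_t 𝓕(∂ⱼψ)(ξ) + (B₁)_ℂ M_t 𝓕ψ(ξ) = 0`.
[cite: Rauch1986, Proof of Theorem p. 483] -/
theorem fwd_eqn_fourierSide (hdet : A₀.det ≠ 0) {ψ : Space d → Fin k → ℂ}
    (hψ : ContDiff ℝ ∞ ψ) (hc : HasCompactSupport ψ) (t : ℝ) (ξ : Space d) :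
    A₀.map (algebraMap ℝ ℂ) *ᵥ fwdSolDtF A₀ A B₁ ψ t ξ +
      ∑ j, (A j).map (algebraMap ℝ ℂ) *ᵥ (rauchSymbol A₀ A B₁ t ξ *ᵥ
        𝓕 (fun y => fderiv ℝ ψ y (EuclideanSpace.single j 1)) ξ) +
      (bMatrix B₁).map (algebraMap ℝ ℂ) *ᵥ (rauchSymbol A₀ A B₁ t ξ *ᵥ 𝓕 ψ ξ) = 0 := by
  have hfd : ∀ j, 𝓕 (fun y => fderiv ℝ ψ y (EuclideanSpace.single j 1)) ξ =
      (2 * Real.pi * ξ j * Complex.I) • 𝓕 ψ ξ :=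
    fun j => fourier_fderiv_apply_single (hψ.of_le (by exact_mod_cast le_top)) hc ξ j
  simp_rw [hfd, Matrix.mulVec_smul, fwdSolDtF, Matrix.mulVec_mulVec, ← Matrix.smul_mulVec,
    ← Matrix.sum_mulVec, ← Matrix.add_mulVec]
  rw [← Matrix.mul_assoc, Matrix.mul_neg, map_A0_mul_rauchGenerator hdet, Matrix.neg_mul,
    Matrix.add_mul, Finset.sum_mul]
  simp_rw [Matrix.smul_mul]
  rw [show (-(∑ j, (2 * Real.pi * ξ j * Complex.I) • ((A j).map (algebraMap ℝ ℂ) *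
      rauchSymbol A₀ A B₁ t ξ) + (bMatrix B₁).map (algebraMap ℝ ℂ) * rauchSymbol A₀ A B₁ t ξ) +
      ∑ j, (2 * Real.pi * ξ j * Complex.I) • ((A j).map (algebraMap ℝ ℂ) *
        rauchSymbol A₀ A B₁ t ξ) +
      (bMatrix B₁).map (algebraMap ℝ ℂ) * rauchSymbol A₀ A B₁ t ξ) = 0 by abel,
    Matrix.zero_mulVec]

/-- `x ↦ ∂ₜv(t, x)` is continuous. [folklore] -/
theorem continuous_fwdSolDt (hS : (ofConstant A₀ A B₁).IsRauchClass 0)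
    {ψ : Space d → Fin k → ℂ} (hψ : ContDiff ℝ ∞ ψ) (hc : HasCompactSupport ψ) (t : ℝ) :
    Continuous (fwdSolDt A₀ A B₁ ψ t) := by
  obtain ⟨C₀, hC0, hC⟩ := exists_symbolBound hS |t|
  exact continuous_fourierInv_of_integrable (integrable_fwdSolDtF hC0 (hC t le_rfl) hψ hc)

/-- **The equation**: `A₀_ℂ ∂ₜv(t, x) + Σⱼ (Aⱼ)_ℂ ∂ⱼv(t, x) + (B₁)_ℂ v(t, x) = 0` for all `t, x`.
[cite: Rauch1986, (4) p. 482 and Proof of Theorem p. 483] -/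
theorem fwd_eqn (hS : (ofConstant A₀ A B₁).IsRauchClass 0) {ψ : Space d → Fin k → ℂ}
    (hψ : ContDiff ℝ ∞ ψ) (hc : HasCompactSupport ψ) (t : ℝ) (x : Space d) :
    A₀.map (algebraMap ℝ ℂ) *ᵥ fwdSolDt A₀ A B₁ ψ t x +
      ∑ j, (A j).map (algebraMap ℝ ℂ) *ᵥ
        fderiv ℝ (fwdSolC A₀ A B₁ ψ t) x (EuclideanSpace.single j 1) +
      (bMatrix B₁).map (algebraMap ℝ ℂ) *ᵥ fwdSolC A₀ A B₁ ψ t x = 0 := by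
  have hdet := det_ne_zero_of_isRauchClass hS
  obtain ⟨C₀, hC0, hC⟩ := exists_symbolBound hS |t|
  have hCt := hC t le_rfl
  -- the spatial derivatives as multiplier outputs
  have hψj : ∀ j, ContDiff ℝ ∞ fun y => fderiv ℝ ψ y (EuclideanSpace.single j 1) := fun j =>
    (hψ.fderiv_right (m := ∞) (by exact_mod_cast le_top)).clm_apply contDiff_const
  have hcj : ∀ j, HasCompactSupport fun y => fderiv ℝ ψ y (EuclideanSpace.single j 1) :=
    fun j => (hc.fderiv ℝ).comp_left (g := fun L : Space d →L[ℝ] (Fin k → ℂ) =>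
      L (EuclideanSpace.single j 1)) rfl
  set gj : Fin d → Space d → Fin k → ℂ := fun j ξ => rauchSymbol A₀ A B₁ t ξ *ᵥ
    𝓕 (fun y => fderiv ℝ ψ y (EuclideanSpace.single j 1)) ξ with hgj
  have hgi : ∀ j, Integrable (gj j) := fun j =>
    integrable_rauchSymbol_mulVec_fourier hC0 hCt (hψj j) (hcj j)
  have hfd : ∀ j, fderiv ℝ (fwdSolC A₀ A B₁ ψ t) x (EuclideanSpace.single j 1) = 𝓕⁻ (gj j) x := by
    intro j
    rw [fderiv_fwdSolC_apply hS hψ hc t x, fwdSolC, multiplierOp_apply]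
  simp_rw [hfd]
  -- the zeroth-order output
  set g0 : Space d → Fin k → ℂ := fun ξ => rauchSymbol A₀ A B₁ t ξ *ᵥ 𝓕 ψ ξ with hg0
  have hg0i : Integrable g0 := integrable_rauchSymbol_mulVec_fourier hC0 hCt hψ hc
  have hw : fwdSolC A₀ A B₁ ψ t x = 𝓕⁻ g0 x := by rw [fwdSolC, multiplierOp_apply]
  rw [hw]
  -- pull the constant matrices inside and add up
  have hdt := integrable_fwdSolDtF hC0 hCt hψ hc (A₀ := A₀) (A := A) (B₁ := B₁)
  set Bt : Matrix (Fin k) (Fin k) ℂ := (bMatrix B₁).map (algebraMap ℝ ℂ) with hBt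
  rw [fwdSolDt, ← congrFun (fourierInv_mulVec (A₀.map (algebraMap ℝ ℂ)) hdt) x,
    ← congrFun (fourierInv_mulVec Bt hg0i) x]
  have hsum : ∀ j, (A j).map (algebraMap ℝ ℂ) *ᵥ 𝓕⁻ (gj j) x =
      𝓕⁻ (fun ξ => (A j).map (algebraMap ℝ ℂ) *ᵥ gj j ξ) x :=
    fun j => (congrFun (fourierInv_mulVec ((A j).map (algebraMap ℝ ℂ)) (hgi j)) x).symm
  simp_rw [hsum, Real.fourierInv_eq_fourier_neg]
  have hi1 : Integrable fun ξ => A₀.map (algebraMap ℝ ℂ) *ᵥ fwdSolDtF A₀ A B₁ ψ t ξ := by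
    simpa using (mulVecBilin (A₀.map (algebraMap ℝ ℂ))).integrable_comp hdt
  have hi2 : ∀ j, Integrable fun ξ => (A j).map (algebraMap ℝ ℂ) *ᵥ gj j ξ := fun j => by
    simpa using (mulVecBilin ((A j).map (algebraMap ℝ ℂ))).integrable_comp (hgi j)
  have hi3 : Integrable fun ξ => Bt *ᵥ g0 ξ := by
    simpa using (mulVecBilin Bt).integrable_comp hg0i
  have hi12 : Integrable fun ξ => A₀.map (algebraMap ℝ ℂ) *ᵥ fwdSolDtF A₀ A B₁ ψ t ξ +
      ∑ j, (A j).map (algebraMap ℝ ℂ) *ᵥ gj j ξ :=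
    hi1.add (integrable_finsetSum _ fun j _ => hi2 j)
  rw [← fourier_finset_sum_apply hi2, ← fourier_add_apply hi1
    (integrable_finsetSum _ fun j _ => hi2 j), ← fourier_add_apply hi12 hi3]
  have hzero : (fun ξ => A₀.map (algebraMap ℝ ℂ) *ᵥ fwdSolDtF A₀ A B₁ ψ t ξ +
      ∑ j, (A j).map (algebraMap ℝ ℂ) *ᵥ gj j ξ + Bt *ᵥ g0 ξ) = fun _ => 0 := by
    funext ξ
    exact fwd_eqn_fourierSide hdet hψ hc t ξ
  rw [hzero]
  exact fourier_zero_apply (-x)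


/-! ### Joint regularity in `(t, x)` -/

/-- The phase `(ξ, x) ↦ e^{2πi⟨ξ, x⟩}` is jointly continuous. [folklore] -/
theorem continuous_phase_uncurry :
    Continuous fun q : Space d × Space d =>
      Complex.exp (((2 * Real.pi * ⟪q.1, q.2⟫ : ℝ) : ℂ) * I) :=
  Complex.continuous_exp.comp ((Complex.continuous_ofReal.comp
    (continuous_const.mul (continuous_fst.inner continuous_snd))).mul continuous_const)

set_option maxHeartbeats 400000 in
/-- **The Fourier solution is jointly continuous in `(t, x)`** (dominated convergence, with the
majorant `kC₀‖𝓕ψ‖` on `|t| < |t₀| + 1`). [folklore] -/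
theorem continuous_fwdSolC_uncurry (hS : (ofConstant A₀ A B₁).IsRauchClass 0)
    {ψ : Space d → Fin k → ℂ} (hψ : ContDiff ℝ ∞ ψ) (hc : HasCompactSupport ψ) :
    Continuous fun p : ℝ × Space d => fwdSolC A₀ A B₁ ψ p.1 p.2 := by
  have hψF : Continuous (𝓕 ψ) := continuous_fourier_of_contDiff hψ hc
  -- the integrand, as a function of the parameter `p = (t, x)` and of `ξ`
  set F : ℝ × Space d → Space d → Fin k → ℂ := fun p ξ =>
    Complex.exp (((2 * Real.pi * ⟪ξ, p.2⟫ : ℝ) : ℂ) * I) • (rauchSymbol A₀ A B₁ p.1 ξ *ᵥ 𝓕 ψ ξ)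
    with hF
  have hfun : (fun p : ℝ × Space d => fwdSolC A₀ A B₁ ψ p.1 p.2) = fun p => ∫ ξ, F p ξ := by
    funext p
    rw [fwdSolC, multiplierOp_apply, Real.fourierInv_eq']
  rw [hfun]
  have hFj : Continuous fun q : (ℝ × Space d) × Space d => F q.1 q.2 := by
    have hph : Continuous fun q : (ℝ × Space d) × Space d =>
        Complex.exp (((2 * Real.pi * ⟪q.2, q.1.2⟫ : ℝ) : ℂ) * I) :=
      continuous_phase_uncurry.comp (continuous_snd.prodMk (continuous_snd.comp continuous_fst))
    have hre : Continuous fun q : (ℝ × Space d) × Space d =>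
        rauchSymbol A₀ A B₁ q.1.1 q.2 *ᵥ 𝓕 ψ q.2 :=
      continuous_rauchSymbol_mulVec_fourier_comp (continuous_fst.comp continuous_fst)
        continuous_snd hψ hc
    exact hph.smul hre
  refine continuous_iff_continuousAt.2 fun p₀ => ?_
  obtain ⟨C₀, hC0, hC⟩ := exists_symbolBound hS (|p₀.1| + 1)
  have hU : {p : ℝ × Space d | |p.1| < |p₀.1| + 1} ∈ 𝓝 p₀ :=
    (isOpen_lt (continuous_abs.comp continuous_fst) continuous_const).mem_nhds (by
      show |p₀.1| < |p₀.1| + 1; linarith)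
  have hFj' : Continuous (Function.uncurry F) := hFj
  refine continuousAt_of_dominated (μ := (volume : Measure (Space d)))
    (bound := fun ξ => (k * C₀) * ‖𝓕 ψ ξ‖) ?_ ?_ ?_ ?_
  · exact Eventually.of_forall fun p => (hFj'.uncurry_left p).aestronglyMeasurable
  · filter_upwards [hU] with p hp
    refine Eventually.of_forall fun ξ => ?_
    rw [hF]
    dsimp only
    rw [norm_smul, Complex.norm_exp_ofReal_mul_I, one_mul]
    exact norm_rauchSymbol_mulVec_le hC0 (hC p.1 hp.le) (𝓕 ψ ξ) ξ
  · exact (integrable_fourier_of_contDiff hψ hc).norm.const_mul _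
  · exact Eventually.of_forall fun ξ => (hFj'.uncurry_right ξ).continuousAt

set_option maxHeartbeats 400000 in
/-- **The time derivative is jointly continuous in `(t, x)`** (dominated convergence, with the
majorant `kC₀(K₀ + K₁‖ξ‖)‖𝓕ψ‖` on `|t| < |t₀| + 1`). [folklore] -/
theorem continuous_fwdSolDt_uncurry (hS : (ofConstant A₀ A B₁).IsRauchClass 0)
    {ψ : Space d → Fin k → ℂ} (hψ : ContDiff ℝ ∞ ψ) (hc : HasCompactSupport ψ) :
    Continuous fun p : ℝ × Space d => fwdSolDt A₀ A B₁ ψ p.1 p.2 := by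
  have hψF : Continuous (𝓕 ψ) := continuous_fourier_of_contDiff hψ hc
  set F : ℝ × Space d → Space d → Fin k → ℂ := fun p ξ =>
    Complex.exp (((2 * Real.pi * ⟪ξ, p.2⟫ : ℝ) : ℂ) * I) • fwdSolDtF A₀ A B₁ ψ p.1 ξ with hF
  have hfun : (fun p : ℝ × Space d => fwdSolDt A₀ A B₁ ψ p.1 p.2) = fun p => ∫ ξ, F p ξ := by
    funext p
    rw [fwdSolDt, Real.fourierInv_eq']
  rw [hfun]
  have hFj : Continuous fun q : (ℝ × Space d) × Space d => F q.1 q.2 := by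
    have hph : Continuous fun q : (ℝ × Space d) × Space d =>
        Complex.exp (((2 * Real.pi * ⟪q.2, q.1.2⟫ : ℝ) : ℂ) * I) :=
      continuous_phase_uncurry.comp (continuous_snd.prodMk (continuous_snd.comp continuous_fst))
    have hre : Continuous fun q : (ℝ × Space d) × Space d => fwdSolDtF A₀ A B₁ ψ q.1.1 q.2 :=
      continuous_fwdSolDtF_comp (continuous_fst.comp continuous_fst) continuous_snd hψ hc
    exact hph.smul hre
  refine continuous_iff_continuousAt.2 fun p₀ => ?_
  obtain ⟨C₀, hC0, hC⟩ := exists_symbolBound hS (|p₀.1| + 1)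
  have hU : {p : ℝ × Space d | |p.1| < |p₀.1| + 1} ∈ 𝓝 p₀ :=
    (isOpen_lt (continuous_abs.comp continuous_fst) continuous_const).mem_nhds (by
      show |p₀.1| < |p₀.1| + 1; linarith)
  have hFj' : Continuous (Function.uncurry F) := hFj
  refine continuousAt_of_dominated (μ := (volume : Measure (Space d))) (bound := fun ξ => (k * C₀) *
      (genBound₀ A₀ B₁ * ‖𝓕 ψ ξ‖ + genBound₁ A₀ A * (‖ξ‖ * ‖𝓕 ψ ξ‖))) ?_ ?_ ?_ ?_
  · exact Eventually.of_forall fun p => (hFj'.uncurry_left p).aestronglyMeasurable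
  · filter_upwards [hU] with p hp
    refine Eventually.of_forall fun ξ => ?_
    rw [hF]
    dsimp only
    rw [norm_smul, Complex.norm_exp_ofReal_mul_I, one_mul]
    exact norm_fwdSolDtF_le hC0 (hC p.1 hp.le) ψ ξ
  · exact integrable_fwdMajorant hψ hc _
  · exact Eventually.of_forall fun ξ => (hFj'.uncurry_right ξ).continuousAt

/-- The data `∂ⱼψ` of the spatial derivatives. [folklore] -/
theorem contDiff_fderiv_apply_single {ψ : Space d → Fin k → ℂ} (hψ : ContDiff ℝ ∞ ψ) (j : Fin d) :
    ContDiff ℝ ∞ fun y => fderiv ℝ ψ y (EuclideanSpace.single j 1) :=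
  (hψ.fderiv_right (m := ∞) (by exact_mod_cast le_top)).clm_apply contDiff_const

/-- The data `∂ⱼψ` are compactly supported. [folklore] -/
theorem hasCompactSupport_fderiv_apply_single {ψ : Space d → Fin k → ℂ}
    (hc : HasCompactSupport ψ) (j : Fin d) :
    HasCompactSupport fun y => fderiv ℝ ψ y (EuclideanSpace.single j 1) :=
  (hc.fderiv ℝ).comp_left (g := fun L : Space d →L[ℝ] (Fin k → ℂ) =>
    L (EuclideanSpace.single j 1)) rfl

/-- **The spatial derivative of the Fourier solution, as a continuous linear map**:
`D_x v(t, x) = Σⱼ eⱼ* ⊗ M_t(D)(∂ⱼψ)(x)`. [folklore] -/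
theorem fderiv_fwdSolC_eq_sum (hS : (ofConstant A₀ A B₁).IsRauchClass 0)
    {ψ : Space d → Fin k → ℂ} (hψ : ContDiff ℝ ∞ ψ) (hc : HasCompactSupport ψ) (t : ℝ)
    (x : Space d) :
    fderiv ℝ (fwdSolC A₀ A B₁ ψ t) x = ∑ j, (EuclideanSpace.proj j).smulRight
      (fwdSolC A₀ A B₁ (fun y => fderiv ℝ ψ y (EuclideanSpace.single j 1)) t x) := by
  ext v i
  have hv : v = ∑ j, v j • EuclideanSpace.single j (1 : ℝ) := by
    conv_lhs => rw [← (EuclideanSpace.basisFun (Fin d) ℝ).sum_repr v]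
    simp [EuclideanSpace.basisFun_apply]
  conv_lhs => rw [hv]
  rw [map_sum]
  simp only [map_smul, _root_.sum_apply, Finset.sum_apply,
    ContinuousLinearMap.smulRight_apply, Pi.smul_apply]
  refine Finset.sum_congr rfl fun j _ => ?_
  rw [fderiv_fwdSolC_apply hS hψ hc t x]
  rfl

/-- **The Fourier solution is jointly `C¹` in `(t, x)`**: its partial derivatives
`∂ₜv = 𝓕⁻¹[-GM_t𝓕ψ]` and `D_xv = Σⱼ eⱼ* ⊗ M_t(D)∂ⱼψ` exist everywhere and are jointly
continuous, so `v` is `C¹` (Dieudonné (8.9.1), `contDiffOn_succ_of_partial`). [folklore] -/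
theorem contDiff_one_fwdSolC (hS : (ofConstant A₀ A B₁).IsRauchClass 0)
    {ψ : Space d → Fin k → ℂ} (hψ : ContDiff ℝ ∞ ψ) (hc : HasCompactSupport ψ) :
    ContDiff ℝ 1 fun p : ℝ × Space d => fwdSolC A₀ A B₁ ψ p.1 p.2 := by
  -- the two partial-derivative fields
  set f₁ : ℝ × Space d → ℝ →L[ℝ] (Fin k → ℂ) := fun p =>
    (1 : ℝ →L[ℝ] ℝ).smulRight (fwdSolDt A₀ A B₁ ψ p.1 p.2) with hf₁
  set f₂ : ℝ × Space d → Space d →L[ℝ] (Fin k → ℂ) := fun p =>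
    ∑ j, (EuclideanSpace.proj j).smulRight
      (fwdSolC A₀ A B₁ (fun y => fderiv ℝ ψ y (EuclideanSpace.single j 1)) p.1 p.2) with hf₂
  have h₁ : ∀ p ∈ (univ : Set (ℝ × Space d)),
      HasFDerivAt (fun a : ℝ => fwdSolC A₀ A B₁ ψ (a, p.2).1 (a, p.2).2) (f₁ p) p.1 :=
    fun p _ => (hasDerivAt_fwdSolC hS hψ hc p.2 p.1).hasFDerivAt
  have h₂ : ∀ p ∈ (univ : Set (ℝ × Space d)),
      HasFDerivAt (fun b : Space d => fwdSolC A₀ A B₁ ψ (p.1, b).1 (p.1, b).2) (f₂ p) p.2 := by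
    intro p _
    have h := ((differentiable_fwdSolC hS hψ hc p.1) p.2).hasFDerivAt
    rw [fderiv_fwdSolC_eq_sum hS hψ hc p.1 p.2] at h
    exact h
  have hc₁ : ContDiffOn ℝ 0 f₁ univ := by
    rw [contDiffOn_zero]
    refine Continuous.continuousOn ?_
    have : f₁ = fun p => ContinuousLinearMap.smulRightL ℝ ℝ (Fin k → ℂ) (1 : ℝ →L[ℝ] ℝ)
        (fwdSolDt A₀ A B₁ ψ p.1 p.2) := by
      funext p; rw [hf₁]; rfl
    rw [this]
    exact (ContinuousLinearMap.smulRightL ℝ ℝ (Fin k → ℂ) (1 : ℝ →L[ℝ] ℝ)).continuous.comp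
      (continuous_fwdSolDt_uncurry hS hψ hc)
  have hc₂ : ContDiffOn ℝ 0 f₂ univ := by
    rw [contDiffOn_zero]
    refine Continuous.continuousOn ?_
    have : f₂ = fun p => ∑ j, ContinuousLinearMap.smulRightL ℝ (Space d) (Fin k → ℂ) (EuclideanSpace.proj j)
        (fwdSolC A₀ A B₁ (fun y => fderiv ℝ ψ y (EuclideanSpace.single j 1)) p.1 p.2) := by
      funext p; rw [hf₂]; rfl
    rw [this]
    refine continuous_finsetSum _ fun j _ => ?_
    exact (ContinuousLinearMap.smulRightL ℝ (Space d) (Fin k → ℂ) (EuclideanSpace.proj j)).continuous.comp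
      (continuous_fwdSolC_uncurry hS (contDiff_fderiv_apply_single hψ j)
        (hasCompactSupport_fderiv_apply_single hc j))
  have h := contDiffOn_succ_of_partial (f := fun p : ℝ × Space d => fwdSolC A₀ A B₁ ψ p.1 p.2)
    isOpen_univ h₁ h₂ hc₁ hc₂
  rw [contDiffOn_univ] at h
  exact_mod_cast h


/-! ### Real data: the classical solution of the linearised system -/

/-- `Re (y_ℂ) = y`. [folklore] -/
@[simp] theorem rePi_ofRealPi (y : Fin k → ℝ) : rePi (ofRealPi y) = y := by
  ext i; simp [rePi_apply, ofRealPi_apply]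

/-- Real matrices commute with the componentwise real part: `Re (M_ℂ z) = M (Re z)`. [folklore] -/
theorem rePi_map_mulVec (M : Matrix (Fin k) (Fin k) ℝ) (z : Fin k → ℂ) :
    rePi (M.map (algebraMap ℝ ℂ) *ᵥ z) = M *ᵥ rePi z := by
  ext i
  simp only [rePi_apply, Matrix.mulVec, dotProduct, Matrix.map_apply, Complex.re_sum]
  refine Finset.sum_congr rfl fun j _ => ?_
  simp

variable (A₀ A B₁) in
/-- **The classical solution of the linearised system with real data** `φ ∈ C_c^∞(ℝᵈ; ℝᵏ)`:
`v(t) = Re M_t(D)φ_ℂ`. [cite: Rauch1986, (4) p. 482 and Proof of Theorem p. 483] -/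
def fourierSolution (φ : Space d → Fin k → ℝ) (t : ℝ) (x : Space d) : Fin k → ℝ :=
  rePi (fwdSolC A₀ A B₁ (cplx φ) t x)

/-- **`v(0) = φ`**. [folklore] -/
theorem fourierSolution_zero {φ : Space d → Fin k → ℝ} (hφ : ContDiff ℝ ∞ φ)
    (hφc : HasCompactSupport φ) (x : Space d) : fourierSolution A₀ A B₁ φ 0 x = φ x := by
  rw [fourierSolution, fwdSolC_zero hφ.cplx hφc.cplx x, cplx_apply, rePi_ofRealPi]

/-- `v` is jointly `C¹` in `(t, x)`. [folklore] -/
theorem contDiff_one_fourierSolution (hS : (ofConstant A₀ A B₁).IsRauchClass 0)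
    {φ : Space d → Fin k → ℝ} (hφ : ContDiff ℝ ∞ φ) (hφc : HasCompactSupport φ) :
    ContDiff ℝ 1 (Function.uncurry (fourierSolution A₀ A B₁ φ)) :=
  rePi.contDiff.comp (contDiff_one_fwdSolC hS hφ.cplx hφc.cplx)

/-- The time derivative of `v`: `∂ₜv(t, x) = Re ∂ₜv_ℂ(t, x)`. [folklore] -/
theorem hasDerivAt_fourierSolution (hS : (ofConstant A₀ A B₁).IsRauchClass 0)
    {φ : Space d → Fin k → ℝ} (hφ : ContDiff ℝ ∞ φ) (hφc : HasCompactSupport φ) (x : Space d)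
    (t : ℝ) :
    HasDerivAt (fun s => fourierSolution A₀ A B₁ φ s x)
      (rePi (fwdSolDt A₀ A B₁ (cplx φ) t x)) t :=
  (rePi.hasFDerivAt.comp_hasDerivAt t (hasDerivAt_fwdSolC hS hφ.cplx hφc.cplx x t) :)

/-- The spatial derivatives of `v`: `∂ᵥv(t, x) = Re ∂ᵥv_ℂ(t, x)`. [folklore] -/
theorem fderiv_fourierSolution_apply (hS : (ofConstant A₀ A B₁).IsRauchClass 0)
    {φ : Space d → Fin k → ℝ} (hφ : ContDiff ℝ ∞ φ) (hφc : HasCompactSupport φ) (t : ℝ)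
    (x v : Space d) :
    fderiv ℝ (fourierSolution A₀ A B₁ φ t) x v = rePi (fderiv ℝ (fwdSolC A₀ A B₁ (cplx φ) t) x v) := by
  have h := (differentiable_fwdSolC hS hφ.cplx hφc.cplx t) x
  have h2 : fourierSolution A₀ A B₁ φ t = rePi ∘ fwdSolC A₀ A B₁ (cplx φ) t := rfl
  rw [h2, fderiv_comp x rePi.differentiableAt h, rePi.fderiv]
  rfl

/-- **The equation for `v`**: `A₀ ∂ₜv + Σⱼ Aⱼ ∂ⱼv + B₁ v = 0` at every `(t, x)`, with the true time
derivative. [cite: Rauch1986, (4) p. 482] -/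
theorem fourierSolution_eqn (hS : (ofConstant A₀ A B₁).IsRauchClass 0)
    {φ : Space d → Fin k → ℝ} (hφ : ContDiff ℝ ∞ φ) (hφc : HasCompactSupport φ) (t : ℝ)
    (x : Space d) :
    A₀ *ᵥ deriv (fun s => fourierSolution A₀ A B₁ φ s x) t +
      ∑ j, A j *ᵥ fderiv ℝ (fourierSolution A₀ A B₁ φ t) x (EuclideanSpace.single j 1) +
      B₁ (fourierSolution A₀ A B₁ φ t x) = 0 := by
  have h := congr_arg rePi (fwd_eqn hS hφ.cplx hφc.cplx t x)
  rw [map_add, map_add, map_sum, map_zero, rePi_map_mulVec, rePi_map_mulVec] at h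
  simp_rw [rePi_map_mulVec] at h
  rw [(hasDerivAt_fourierSolution hS hφ hφc x t).deriv, bMatrix_mulVec] at *
  simp_rw [fderiv_fourierSolution_apply hS hφ hφc t x]
  exact h

/-- **The Fourier solution is a classical solution of the linearised system on `[0, T]`**
(`T > 0`), in the sense of `QuasilinearSystem.IsClassicalSolution`: jointly `C¹`, and the
equation with the one-sided time derivative within `[0, T]` (which is the true derivative).
[cite: Rauch1986, (4) and Local Existence Theorem p. 482] -/
theorem isClassicalSolution_fourierSolution (hS : (ofConstant A₀ A B₁).IsRauchClass 0) {T : ℝ}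
    (hT : 0 < T) {φ : Space d → Fin k → ℝ} (hφ : ContDiff ℝ ∞ φ) (hφc : HasCompactSupport φ) :
    (ofConstant A₀ A B₁).IsClassicalSolution T (fourierSolution A₀ A B₁ φ) where
  contDiffOn := (contDiff_one_fourierSolution hS hφ hφc).contDiffOn
  eqn := by
    intro t ht x
    simp only [ofConstant_A0, ofConstant_A, ofConstant_B, timeDerivWithin_apply]
    rw [(hasDerivAt_fourierSolution hS hφ hφc x t).hasDerivWithinAt.derivWithin
      (uniqueDiffOn_Icc hT t ht), ← (hasDerivAt_fourierSolution hS hφ hφc x t).deriv]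
    exact fourierSolution_eqn hS hφ hφc t x

/-- **Compact support of the slices**: if `φ = 0` for `‖x‖ > R` then `v(t, x) = 0` for
`‖x‖ > R + ct`, `0 ≤ t ≤ T`, with the propagation speed `c` of the tree
(`hasPropagationSpeed_ofConstant_zeroth`). [cite: Rauch1986, Proof of Theorem p. 482] -/
theorem exists_speed_fourierSolution_eq_zero (hS : (ofConstant A₀ A B₁).IsRauchClass 0) :
    ∃ c : ℝ, 0 ≤ c ∧ ∀ {T : ℝ}, 0 < T → ∀ {φ : Space d → Fin k → ℝ}, ContDiff ℝ ∞ φ →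
      HasCompactSupport φ → ∀ {R : ℝ}, (∀ x : Space d, R < ‖x‖ → φ x = 0) →
        ∀ t ∈ Icc 0 T, ∀ x : Space d, R + c * t < ‖x‖ → fourierSolution A₀ A B₁ φ t x = 0 := by
  obtain ⟨c, hc, hps⟩ := hasPropagationSpeed_ofConstant_zeroth hS
  refine ⟨c, hc, fun hT φ hφ hφc R hR t ht x hx => ?_⟩
  exact hps _ R _ (isClassicalSolution_fourierSolution hS hT hφ hφc)
    (fun y hy => by rw [fourierSolution_zero hφ hφc y, hR y hy]) t ht x hx

/-- **The Fourier transform of the slices**: `𝓕 v(t)_ℂ = M_t 𝓕φ_ℂ` on `[0, T]`.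
[cite: Rauch1986, Proof of Theorem p. 483] -/
theorem fourier_cplx_fourierSolution (hS : (ofConstant A₀ A B₁).IsRauchClass 0) {T : ℝ}
    (hT : 0 < T) {φ : Space d → Fin k → ℝ} (hφ : ContDiff ℝ ∞ φ) (hφc : HasCompactSupport φ)
    {t : ℝ} (ht : t ∈ Icc 0 T) (ξ : Space d) :
    𝓕 (cplx (fourierSolution A₀ A B₁ φ t)) ξ = rauchSymbol A₀ A B₁ t ξ *ᵥ 𝓕 (cplx φ) ξ := by
  obtain ⟨c, hc, hps⟩ := hasPropagationSpeed_ofConstant_zeroth hS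
  have h0 : HasCompactSupport (fourierSolution A₀ A B₁ φ 0) := by
    have : fourierSolution A₀ A B₁ φ 0 = φ := funext fun y => fourierSolution_zero hφ hφc y
    rw [this]; exact hφc
  have h := fourier_cplx_slice_eq_of_hasPropagationSpeed (det_ne_zero_of_isRauchClass hS) hc hps
    (isClassicalSolution_fourierSolution hS hT hφ hφc) h0 ht ξ
  have h0' : cplx (fourierSolution A₀ A B₁ φ 0) = cplx φ := by
    funext y; rw [cplx_apply, cplx_apply, fourierSolution_zero hφ hφc y]
  rwa [h0'] at h

end Forward

end Literature.Barriers.AtomisticToContinuum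

end
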